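import Literature.NumberTheory.Transcendental.BeukersZetaThreeIntegrals
import HarnessLib

/-!
# Beukers' integrals for `ζ(3)` — proofs: `I_0 = 2ζ(3)`

Sibling proof file of `BeukersZetaThreeIntegrals.lean`. It discharges the named fact
`Literature.NumberTheory.Transcendental.Beukers.tripleIntegral_zero`
(`tripleIntegral 0 = 2 * zetaValue 3`, i.e. `∫∫∫_{(0,1)³} dx dy dw/(1-(1-xy)w) = 2ζ(3)`) as
`Beukers.tripleIntegral_zero_holds`.

## Source and proof architecture

G. E. Andrews, R. Askey, R. Roy, *Special Functions* (CUP 1999), §7.7 "The irrationality of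
`ζ(3)`", proof of Lemma 7.7.5, last display (p. 393):
`∫₀¹∫₀¹∫₀¹ dx dy dω/(1-(1-xy)ω) = ∫₀¹∫₀¹ -log(xy)/(1-xy) dx dy = 2ζ(3)`,
the first equality being the observation `-log(xy)/(1-xy) = ∫₀¹ dz/(1-(1-xy)z)` of the proof
of Lemma 7.7.4 (p. 392) and the second Lemma 7.7.3 at `r = s = 0` (p. 391), which the book
proves by differentiating `∫∫ x^{r+σ}y^{s+σ}/(1-xy) = ∑ₖ (k+r+σ+1)⁻¹(k+s+σ+1)⁻¹` in `σ`.

Formalisation: all integrands are nonnegative on the open cube, so the Bochner set integral is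
computed as a lower Lebesgue integral (`integral_eq_lintegral_of_nonneg_ae`), the cube integral
is written as an iterated integral by Tonelli (`MeasureTheory.lmarginal`, peeled coordinate by
coordinate: `lintegral_pi_fin_three`), the `w`-integral is evaluated by the substitution
`u = 1-(1-xy)w` (`inner_lintegral_eq`, step 1), and — the one deviation from the printed
`σ`-differentiation, shorter in Lean — Lemma 7.7.3 at `r = s = 0` is obtained by expanding
`-log(xy)/(1-xy) = ∑ₖ -log(xy)(xy)ᵏ`, splitting `-log(xy) = -log x - log y`, and using
`∫₀¹ xᵏ dx = 1/(k+1)` and `∫₀¹ -log(x) xᵏ dx = 1/(k+1)²` (what the `σ`-derivative of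
`∫₀¹ x^{k+σ} dx = 1/(k+σ+1)` computes), whence `∑ₖ 2/(k+1)³ = 2ζ(3)`.

## References
* [AndrewsAskeyRoy1999] G. E. Andrews, R. Askey, R. Roy, Special Functions, CUP (1999), §7.7,
  Lemmas 7.7.3–7.7.5, pp. 391–393, doi:10.1017/cbo9781107325937.
* [Beukers1979] F. Beukers, A note on the irrationality of `ζ(2)` and `ζ(3)`, Bull. London Math.
  Soc. 11 (1979) 268–272 (primary source of the argument).
-/

noncomputable section

open MeasureTheory Set

namespace Literature.NumberTheory.Transcendental

namespace Beukers

/-- Iterated-integral (Tonelli) form of a lower Lebesgue integral over `Fin 3 → ℝ` against a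
product measure (Mathlib's `lmarginal` peeled three times). [folklore] -/
private lemma lintegral_pi_fin_three (ν : Measure ℝ) [SigmaFinite ν]
    {f : (Fin 3 → ℝ) → ENNReal} (hf : Measurable f) :
    ∫⁻ p, f p ∂Measure.pi (fun _ : Fin 3 => ν) = ∫⁻ x, ∫⁻ y, ∫⁻ w, f ![x, y, w] ∂ν ∂ν ∂ν := by
  rw [lintegral_eq_lmarginal_univ (fun _ => (0 : ℝ))]
  have huniv : (Finset.univ : Finset (Fin 3)) = {0, 1, 2} := by
    ext i; fin_cases i <;> simp
  rw [huniv, lmarginal_insert f hf (i := (0 : Fin 3)) (s := {1, 2}) (by decide)]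
  refine lintegral_congr fun x => ?_
  rw [lmarginal_insert f hf (i := (1 : Fin 3)) (s := {2}) (by decide)]
  refine lintegral_congr fun y => ?_
  rw [lmarginal_singleton]
  refine lintegral_congr fun w => ?_
  congr 1
  ext i; fin_cases i <;> simp

/-- `∫⁻` over `(0,1)` of `ofReal ∘ f` is `ofReal` of the interval integral, for `f`
interval integrable and nonnegative on `(0,1)`. [folklore] -/
private lemma setLIntegral_Ioo_ofReal {f : ℝ → ℝ} (hint : IntervalIntegrable f volume 0 1)
    (hnn : ∀ x ∈ Ioo (0 : ℝ) 1, 0 ≤ f x) :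
    ∫⁻ x in Ioo (0 : ℝ) 1, ENNReal.ofReal (f x) = ENNReal.ofReal (∫ x in (0 : ℝ)..1, f x) := by
  rw [intervalIntegral.integral_of_le zero_le_one, integral_Ioc_eq_integral_Ioo,
    ofReal_integral_eq_lintegral_ofReal]
  · exact (intervalIntegrable_iff_integrableOn_Ioo_of_le zero_le_one).1 hint
  · rw [Filter.EventuallyLE, ae_restrict_iff' measurableSet_Ioo]
    exact Filter.Eventually.of_forall hnn

/-- `∫₀¹ xᵏ dx = 1/(k+1)` as a lower Lebesgue integral. [folklore] -/
private lemma setLIntegral_Ioo_pow (k : ℕ) :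
    ∫⁻ x in Ioo (0 : ℝ) 1, ENNReal.ofReal (x ^ k) = ENNReal.ofReal (1 / ((k : ℝ) + 1)) := by
  rw [setLIntegral_Ioo_ofReal ((continuous_pow k).intervalIntegrable 0 1)
    (fun x hx => pow_nonneg hx.1.le k), integral_pow]
  simp

/-- `∫₀¹ -log(x) xᵏ dx = 1/(k+1)²` as a lower Lebesgue integral (by parts / FTC with the
antiderivative `x^{k+1} log x/(k+1) - x^{k+1}/(k+1)²`). [folklore] -/
private lemma setLIntegral_Ioo_negLog_mul_pow (k : ℕ) :
    ∫⁻ x in Ioo (0 : ℝ) 1, ENNReal.ofReal (-Real.log x * x ^ k) =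
      ENNReal.ofReal (1 / ((k : ℝ) + 1) ^ 2) := by
  have hint' : IntervalIntegrable (fun x => Real.log x * x ^ k) volume 0 1 :=
    intervalIntegral.intervalIntegrable_log'.mul_continuousOn (continuous_pow k).continuousOn
  have hint : IntervalIntegrable (fun x => -Real.log x * x ^ k) volume 0 1 := by
    have : (fun x => -Real.log x * x ^ k) = fun x => -(Real.log x * x ^ k) := by
      funext x; ring
    rw [this]; exact hint'.neg
  rw [setLIntegral_Ioo_ofReal hint (fun x hx =>
    mul_nonneg (neg_nonneg.mpr (Real.log_nonpos hx.1.le hx.2.le)) (pow_nonneg hx.1.le k))]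
  congr 1
  have key : ∫ x in (0 : ℝ)..1, Real.log x * x ^ k = -(1 / ((k : ℝ) + 1) ^ 2) := by
    have hk : (0 : ℝ) < (k : ℝ) + 1 := by positivity
    have hderiv : ∀ x ∈ Ioo (0 : ℝ) 1, HasDerivAt (fun x : ℝ => x ^ (k + 1) * Real.log x /
        ((k : ℝ) + 1) - x ^ (k + 1) / ((k : ℝ) + 1) ^ 2) (Real.log x * x ^ k) x := by
      intro x hx
      have hx0 : x ≠ 0 := hx.1.ne'
      have h1 : HasDerivAt (fun x : ℝ => x ^ (k + 1)) (((k + 1 : ℕ) : ℝ) * x ^ k) x := by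
        simpa using hasDerivAt_pow (k + 1) x
      have h2 : HasDerivAt Real.log x⁻¹ x := Real.hasDerivAt_log hx0
      have h := ((h1.mul h2).div_const ((k : ℝ) + 1)).sub (h1.div_const (((k : ℝ) + 1) ^ 2))
      refine h.congr_deriv ?_
      have hxk : x ^ (k + 1) * x⁻¹ = x ^ k := by
        rw [pow_succ, mul_assoc, mul_inv_cancel₀ hx0, mul_one]
      push_cast
      rw [hxk]
      field_simp
      ring
    have hcont : ContinuousOn (fun x : ℝ => x ^ (k + 1) * Real.log x /
        ((k : ℝ) + 1) - x ^ (k + 1) / ((k : ℝ) + 1) ^ 2) (Icc 0 1) := by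
      have hc : Continuous fun x : ℝ => x ^ (k + 1) * Real.log x := by
        have : (fun x : ℝ => x ^ (k + 1) * Real.log x) = fun x => x ^ k * (x * Real.log x) := by
          funext x; ring
        rw [this]
        exact (continuous_pow k).mul Real.continuous_mul_log
      exact ((hc.div_const _).sub ((continuous_pow (k + 1)).div_const _)).continuousOn
    rw [intervalIntegral.integral_eq_sub_of_hasDerivAt_of_le zero_le_one hcont hderiv hint']
    simp
  have : (fun x => -Real.log x * x ^ k) = fun x => -(Real.log x * x ^ k) := by
    funext x; ring
  rw [this, intervalIntegral.integral_neg, key, neg_neg]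

/-- The `w`-integral and the geometric expansion: for `a, b ∈ (0,1)`,
`∫₀¹ dw/(1-(1-ab)w) = -log(ab)/(1-ab) = ∑ₖ (-log a · aᵏ) bᵏ + aᵏ (-log b · bᵏ)` (in `ℝ≥0∞`).
[cite: AndrewsAskeyRoy1999, §7.7, proof of Lemma 7.7.4 ("observe that
`-log xy/(1-xy) = ∫₀¹ dz/(1-(1-xy)z)`"), p. 392] -/
private lemma inner_lintegral_eq {a b : ℝ} (ha : a ∈ Ioo (0 : ℝ) 1) (hb : b ∈ Ioo (0 : ℝ) 1) :
    ∫⁻ c in Ioo (0 : ℝ) 1, ENNReal.ofReal (1 / (1 - (1 - a * b) * c)) =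
      ∑' k : ℕ, (ENNReal.ofReal (-Real.log a * a ^ k) * ENNReal.ofReal (b ^ k) +
        ENNReal.ofReal (a ^ k) * ENNReal.ofReal (-Real.log b * b ^ k)) := by
  obtain ⟨ha0, ha1⟩ := ha
  obtain ⟨hb0, hb1⟩ := hb
  have hq0 : 0 < a * b := mul_pos ha0 hb0
  have hq1 : a * b < 1 := by nlinarith
  have ht0 : 0 < 1 - a * b := by linarith
  -- Step 1 (AAR: `-log(xy)/(1-xy) = ∫₀¹ dz/(1-(1-xy)z)`).
  have step1 : ∫⁻ c in Ioo (0 : ℝ) 1, ENNReal.ofReal (1 / (1 - (1 - a * b) * c)) =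
      ENNReal.ofReal (-Real.log (a * b) / (1 - a * b)) := by
    have hden : ∀ x ∈ Icc (0 : ℝ) 1, 0 < 1 - (1 - a * b) * x := by
      intro x hx
      have : (1 - a * b) * x ≤ (1 - a * b) * 1 := mul_le_mul_of_nonneg_left hx.2 ht0.le
      nlinarith
    rw [setLIntegral_Ioo_ofReal (f := fun c => 1 / (1 - (1 - a * b) * c))]
    · congr 1
      have h := intervalIntegral.integral_comp_sub_mul (f := fun u : ℝ => u⁻¹) (a := 0) (b := 1)
        ht0.ne' 1
      simp only [mul_zero, sub_zero, mul_one] at h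
      rw [integral_inv_of_pos (by linarith) one_pos, smul_eq_mul] at h
      simp_rw [one_div]
      rw [h, show (1 : ℝ) - (1 - a * b) = a * b by ring, one_div, Real.log_inv]
      field_simp
    · apply ContinuousOn.intervalIntegrable
      rw [Set.uIcc_of_le zero_le_one]
      exact continuousOn_const.div (by fun_prop) fun x hx => (hden x hx).ne'
    · intro x hx
      exact div_nonneg zero_le_one (hden x ⟨hx.1.le, hx.2.le⟩).le
  -- Step 2: geometric expansion.
  have hlog : 0 ≤ -Real.log (a * b) := neg_nonneg.mpr (Real.log_nonpos hq0.le hq1.le)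
  have hgeom : HasSum (fun k : ℕ => -Real.log (a * b) * (a * b) ^ k)
      (-Real.log (a * b) / (1 - a * b)) := by
    rw [div_eq_mul_inv]
    exact (hasSum_geometric_of_lt_one hq0.le hq1).mul_left _
  rw [step1, ← hgeom.tsum_eq, ENNReal.ofReal_tsum_of_nonneg
    (fun k => mul_nonneg hlog (pow_nonneg hq0.le k)) hgeom.summable]
  congr 1
  funext k
  have hla : 0 ≤ -Real.log a := neg_nonneg.mpr (Real.log_nonpos ha0.le ha1.le)
  have hlb : 0 ≤ -Real.log b := neg_nonneg.mpr (Real.log_nonpos hb0.le hb1.le)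
  rw [← ENNReal.ofReal_mul (mul_nonneg hla (pow_nonneg ha0.le k)),
    ← ENNReal.ofReal_mul (pow_nonneg ha0.le k),
    ← ENNReal.ofReal_add (mul_nonneg (mul_nonneg hla (pow_nonneg ha0.le k)) (pow_nonneg hb0.le k))
      (mul_nonneg (pow_nonneg ha0.le k) (mul_nonneg hlb (pow_nonneg hb0.le k)))]
  congr 1
  rw [Real.log_mul ha0.ne' hb0.ne', mul_pow]
  ring

/-- `∑ₖ 2/(k+1)³ = 2ζ(3)` (index shift; the `n = 0` term of `zetaValue 3` is `1/0³ = 0`).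
[folklore] -/
private lemma tsum_two_div_succ_cube : ∑' k : ℕ, 2 / ((k : ℝ) + 1) ^ 3 = 2 * zetaValue 3 := by
  have hs : Summable (fun n : ℕ => 1 / (n : ℝ) ^ 3) :=
    Real.summable_one_div_nat_pow.mpr (by norm_num)
  rw [zetaValue, hs.tsum_eq_zero_add]
  push_cast
  rw [zero_pow three_ne_zero, div_zero, zero_add, ← tsum_mul_left]
  congr 1
  funext k
  ring

/-- Summability of `∑ₖ 2/(k+1)³`. [folklore] -/
private lemma summable_two_div_succ_cube : Summable (fun k : ℕ => 2 / ((k : ℝ) + 1) ^ 3) := by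
  have hs : Summable (fun n : ℕ => 1 / (n : ℝ) ^ 3) :=
    Real.summable_one_div_nat_pow.mpr (by norm_num)
  have hs' : Summable (fun k : ℕ => 1 / ((k : ℝ) + 1) ^ 3) := by
    have := (summable_nat_add_iff 1).mpr hs
    refine this.congr fun k => ?_
    push_cast
    ring
  refine (hs'.mul_left 2).congr fun k => ?_
  ring

/-- The cube integral as a lower Lebesgue integral: `∫⁻_{(0,1)³} 1/(1-(1-xy)w) = 2ζ(3)`.
[cite: AndrewsAskeyRoy1999, §7.7, proof of Lemma 7.7.5, last display, p. 393] -/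
private lemma cube_lintegral_eq :
    ∫⁻ p in {p : Fin 3 → ℝ | ∀ i, p i ∈ Ioo (0 : ℝ) 1},
        ENNReal.ofReal (1 / (1 - (1 - p 0 * p 1) * p 2)) = ENNReal.ofReal (2 * zetaValue 3) := by
  have hS : {p : Fin 3 → ℝ | ∀ i, p i ∈ Ioo (0 : ℝ) 1} = Set.pi univ (fun _ => Ioo (0 : ℝ) 1) := by
    ext p; simp
  have hrestrict : (volume : Measure (Fin 3 → ℝ)).restrict {p | ∀ i, p i ∈ Ioo (0 : ℝ) 1}
      = Measure.pi (fun _ : Fin 3 => (volume : Measure ℝ).restrict (Ioo (0 : ℝ) 1)) := by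
    rw [hS, volume_pi, Measure.restrict_pi_pi]
  have hf : Measurable fun p : Fin 3 → ℝ => ENNReal.ofReal (1 / (1 - (1 - p 0 * p 1) * p 2)) := by
    fun_prop
  rw [hrestrict, lintegral_pi_fin_three _ hf]
  simp only [Matrix.cons_val_zero, Matrix.cons_val_one, Matrix.cons_val_two, Matrix.head_cons,
    Matrix.tail_cons]
  calc ∫⁻ a in Ioo (0 : ℝ) 1, ∫⁻ b in Ioo (0 : ℝ) 1, ∫⁻ c in Ioo (0 : ℝ) 1,
          ENNReal.ofReal (1 / (1 - (1 - a * b) * c))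
      = ∫⁻ a in Ioo (0 : ℝ) 1, ∫⁻ b in Ioo (0 : ℝ) 1,
          ∑' k : ℕ, (ENNReal.ofReal (-Real.log a * a ^ k) * ENNReal.ofReal (b ^ k) +
            ENNReal.ofReal (a ^ k) * ENNReal.ofReal (-Real.log b * b ^ k)) := by
        refine setLIntegral_congr_fun measurableSet_Ioo fun a ha => ?_
        exact setLIntegral_congr_fun measurableSet_Ioo fun b hb => inner_lintegral_eq ha hb
    _ = ∫⁻ a in Ioo (0 : ℝ) 1, ∑' k : ℕ,
          (ENNReal.ofReal (-Real.log a * a ^ k) * ENNReal.ofReal (1 / ((k : ℝ) + 1)) +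
            ENNReal.ofReal (a ^ k) * ENNReal.ofReal (1 / ((k : ℝ) + 1) ^ 2)) := by
        refine lintegral_congr fun a => ?_
        rw [lintegral_tsum fun k => Measurable.aemeasurable (by fun_prop)]
        congr 1
        funext k
        rw [lintegral_add_left (by fun_prop), lintegral_const_mul _ (by fun_prop),
          lintegral_const_mul _ (by fun_prop), setLIntegral_Ioo_pow,
          setLIntegral_Ioo_negLog_mul_pow]
    _ = ∑' k : ℕ, (ENNReal.ofReal (1 / ((k : ℝ) + 1) ^ 2) * ENNReal.ofReal (1 / ((k : ℝ) + 1)) +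
          ENNReal.ofReal (1 / ((k : ℝ) + 1)) * ENNReal.ofReal (1 / ((k : ℝ) + 1) ^ 2)) := by
        rw [lintegral_tsum fun k => Measurable.aemeasurable (by fun_prop)]
        congr 1
        funext k
        rw [lintegral_add_left (by fun_prop), lintegral_mul_const _ (by fun_prop),
          lintegral_mul_const _ (by fun_prop), setLIntegral_Ioo_pow,
          setLIntegral_Ioo_negLog_mul_pow]
    _ = ∑' k : ℕ, ENNReal.ofReal (2 / ((k : ℝ) + 1) ^ 3) := by
        congr 1
        funext k
        have hk : (0 : ℝ) < (k : ℝ) + 1 := by positivity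
        rw [← ENNReal.ofReal_mul (by positivity), ← ENNReal.ofReal_mul (by positivity),
          ← ENNReal.ofReal_add (by positivity) (by positivity)]
        congr 1
        field_simp
        ring
    _ = ENNReal.ofReal (∑' k : ℕ, 2 / ((k : ℝ) + 1) ^ 3) :=
        (ENNReal.ofReal_tsum_of_nonneg (fun k => by positivity) summable_two_div_succ_cube).symm
    _ = ENNReal.ofReal (2 * zetaValue 3) := by rw [tsum_two_div_succ_cube]

/-- **`I_0 = 2ζ(3)`** — discharge of `tripleIntegral_zero`: Beukers' triple integral (7.7.3) at
`n = 0` equals `2ζ(3)`. [cite: AndrewsAskeyRoy1999, §7.7, proof of Lemma 7.7.5 (last display,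
p. 393) with Lemma 7.7.3 at `r = s = 0` (p. 391)] -/
theorem tripleIntegral_zero_holds : tripleIntegral_zero := by
  unfold tripleIntegral_zero tripleIntegral
  have hSmeas : MeasurableSet {p : Fin 3 → ℝ | ∀ i, p i ∈ Ioo (0 : ℝ) 1} := by
    have : {p : Fin 3 → ℝ | ∀ i, p i ∈ Ioo (0 : ℝ) 1} = Set.pi univ (fun _ => Ioo (0 : ℝ) 1) := by
      ext p; simp
    rw [this]
    exact MeasurableSet.univ_pi fun _ => measurableSet_Ioo
  have hnn : 0 ≤ᵐ[volume.restrict {p : Fin 3 → ℝ | ∀ i, p i ∈ Ioo (0 : ℝ) 1}]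
      fun p : Fin 3 → ℝ => 1 / (1 - (1 - p 0 * p 1) * p 2) := by
    filter_upwards [ae_restrict_mem hSmeas] with p hp
    have h0 := hp 0
    have h1 := hp 1
    have h2 := hp 2
    simp only [mem_Ioo] at h0 h1 h2
    have : (1 - p 0 * p 1) * p 2 < 1 := by nlinarith [mul_pos (mul_pos h0.1 h1.1) h2.1]
    exact div_nonneg zero_le_one (by linarith)
  have hmeas : AEStronglyMeasurable (fun p : Fin 3 → ℝ => 1 / (1 - (1 - p 0 * p 1) * p 2))
      (volume.restrict {p : Fin 3 → ℝ | ∀ i, p i ∈ Ioo (0 : ℝ) 1}) :=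
    (show Measurable _ by fun_prop).aestronglyMeasurable
  have hz : 0 ≤ zetaValue 3 := tsum_nonneg fun n => by positivity
  simp only [pow_zero, zero_add, pow_one]
  rw [integral_eq_lintegral_of_nonneg_ae hnn hmeas, cube_lintegral_eq,
    ENNReal.toReal_ofReal (by positivity)]

end Beukers

end Literature.NumberTheory.Transcendental

end
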